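import Mathlib
import HarnessLib
import Summits.CriticalPhenomena.PercolationContinuityZ3.Theorems.PercTreeValueTetrahedronDisjointCoexistenceStubTiledShell
import Literature.Probability.Percolation.RSW
import Literature.Probability.LatticeModels.ThermodynamicLimit

/-!
# Crux `PercTreeValue.TetrahedronHarrisGap` (stmt-CriticalPhenomena-7799), line `SketchIdeator1`
# (closed-collar total covariance, rev 7) — stub `stub_collarShellProbability`

Helper file for the crux skeleton `Cruxes/TetrahedronHarrisGap/Lines/SketchIdeator1.lean`
(lead prover-line-stmt-CriticalPhenomena-7799-c3-0, skeleton rev 7),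
`--supports stmt-CriticalPhenomena-7799`.  No new definitions; everything is stated in the tree's
vocabulary (`bondPercolation`, `zdGraph`, `criticalProbI`, `box`, `innerBoundary`, `openConnIn`).

With `k = ⌊r/8⌋ ≥ 8` (`r ≥ 64`), `R := [−r, 2r]² × [−2r, 3k]` and the collar `R' := R + B(2k − 1)`
(roof `5k − 1`), the closed-shell event `Shell(R, R')` — no open path of `R' ∖ R` from a vertex
adjacent to `R` to a vertex adjacent to `R'ᶜ` — has probability at least `c_X ^ (51³)` at `p_c(ℤ³)`,
GIVEN the annulus non-crossing hypothesis X_B (`PercAnnulusCrossing.CritAnnulusNonCrossing`,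
stmt-CriticalPhenomena-0846, verbatim, taken as a HYPOTHESIS): tile `R' ∖ R` near `R` by the grid of
translated aspect-2 X_B annuli of radius `s = ⌊r/16⌋ − 1`, mesh `g = 2s + 1`, centres
`anchor + g • j`, `j ∈ B(25)` (`≤ 51³` tiles, `anchor = (4k, 4k, −8k)`), and glue the closed annuli by
Harris–FKG — this is exactly the landed `TetrahedronDisjointCoexistence.stub_tiledShell`, whose cover
hypothesis is integer-division bookkeeping for the tile index `q_i = ⌊(u_i − anchor_i + s)/g⌋`, closed by
`omega` (transplanted from `stub_cruxOfTiledShell` of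
`PercTreeValueTetrahedronDisjointCoexistenceTransferD.lean`, same sets `R ⊆ R'`).
-/

noncomputable section

namespace Summit.CriticalPhenomena.PercolationContinuityZ3.Theorems.TetrahedronHarrisGap

open MeasureTheory
open Literature.Probability.Percolation Literature.Probability.LatticeModels
open Summit.CriticalPhenomena.PercolationContinuityZ3.Theorems.TetrahedronDisjointCoexistence

/-- **stub_collarShellProbability** (registered stub of line `SketchIdeator1`, rev 7).  Under X_B
(`PercAnnulusCrossing.CritAnnulusNonCrossing`, verbatim, as a hypothesis) there is `cS > 0`
(namely `c_X ^ (51³)`) such that for every `r ≥ 64`, with `k = ⌊r/8⌋`, `R = [−r, 2r]² × [−2r, 3k]` and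
`R' = R + B(2k − 1)` (both spelled out inline), the closed shell `Shell(R, R')` — no open path of
`R' ∖ R` from a vertex adjacent to `R` to a vertex adjacent to `R'ᶜ` — has `P_{p_c}`-probability
`≥ cS`.  Proof: the tiled shell `stub_tiledShell` over the grid `anchor + (2s+1) • B(25)`,
`s = ⌊r/16⌋ − 1`, `anchor = (4k, 4k, −8k)`, and `c_X ^ |J| ≥ c_X ^ (51³)`. -/
theorem stub_collarShellProbability
    (hXB : ∃ c : ℝ, 0 < c ∧ ∀ n : ℕ, 1 ≤ n →
      (bondPercolation (zdGraph 3) (criticalProbI 3)).real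
          {ω | ∃ x ∈ box 3 n, ∃ y ∈ innerBoundary (zdGraph 3) (box 3 (2 * n)),
            ω ∈ openConnIn ↑(box 3 (2 * n)) x y} ≤ 1 - c) :
    ∃ cS : ℝ, 0 < cS ∧ ∀ r : ℕ, 64 ≤ r →
      cS ≤ (bondPercolation (zdGraph 3) (criticalProbI 3)).real
        {ω | ∀ u ∈ {x : Site 3 | -(r : ℤ) - (2 * ((r : ℤ) / 8) - 1) ≤ x 0 ∧ x 0 ≤ 2 * (r : ℤ) + (2 * ((r : ℤ) / 8) - 1) ∧
                -(r : ℤ) - (2 * ((r : ℤ) / 8) - 1) ≤ x 1 ∧ x 1 ≤ 2 * (r : ℤ) + (2 * ((r : ℤ) / 8) - 1) ∧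
                -(2 * (r : ℤ)) - (2 * ((r : ℤ) / 8) - 1) ≤ x 2 ∧ x 2 ≤ 5 * ((r : ℤ) / 8) - 1} \
              {x : Site 3 | -(r : ℤ) ≤ x 0 ∧ x 0 ≤ 2 * (r : ℤ) ∧ -(r : ℤ) ≤ x 1 ∧ x 1 ≤ 2 * (r : ℤ) ∧
                -(2 * (r : ℤ)) ≤ x 2 ∧ x 2 ≤ 3 * ((r : ℤ) / 8)},
          ∀ w ∈ {x : Site 3 | -(r : ℤ) - (2 * ((r : ℤ) / 8) - 1) ≤ x 0 ∧ x 0 ≤ 2 * (r : ℤ) + (2 * ((r : ℤ) / 8) - 1) ∧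
                -(r : ℤ) - (2 * ((r : ℤ) / 8) - 1) ≤ x 1 ∧ x 1 ≤ 2 * (r : ℤ) + (2 * ((r : ℤ) / 8) - 1) ∧
                -(2 * (r : ℤ)) - (2 * ((r : ℤ) / 8) - 1) ≤ x 2 ∧ x 2 ≤ 5 * ((r : ℤ) / 8) - 1} \
              {x : Site 3 | -(r : ℤ) ≤ x 0 ∧ x 0 ≤ 2 * (r : ℤ) ∧ -(r : ℤ) ≤ x 1 ∧ x 1 ≤ 2 * (r : ℤ) ∧
                -(2 * (r : ℤ)) ≤ x 2 ∧ x 2 ≤ 3 * ((r : ℤ) / 8)},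
          (∃ z ∈ {x : Site 3 | -(r : ℤ) ≤ x 0 ∧ x 0 ≤ 2 * (r : ℤ) ∧ -(r : ℤ) ≤ x 1 ∧ x 1 ≤ 2 * (r : ℤ) ∧
                -(2 * (r : ℤ)) ≤ x 2 ∧ x 2 ≤ 3 * ((r : ℤ) / 8)}, (zdGraph 3).Adj u z) →
          (∃ z ∉ {x : Site 3 | -(r : ℤ) - (2 * ((r : ℤ) / 8) - 1) ≤ x 0 ∧ x 0 ≤ 2 * (r : ℤ) + (2 * ((r : ℤ) / 8) - 1) ∧
                -(r : ℤ) - (2 * ((r : ℤ) / 8) - 1) ≤ x 1 ∧ x 1 ≤ 2 * (r : ℤ) + (2 * ((r : ℤ) / 8) - 1) ∧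
                -(2 * (r : ℤ)) - (2 * ((r : ℤ) / 8) - 1) ≤ x 2 ∧ x 2 ≤ 5 * ((r : ℤ) / 8) - 1}, (zdGraph 3).Adj w z) →
          ω ∉ openConnIn
            ({x : Site 3 | -(r : ℤ) - (2 * ((r : ℤ) / 8) - 1) ≤ x 0 ∧ x 0 ≤ 2 * (r : ℤ) + (2 * ((r : ℤ) / 8) - 1) ∧
                -(r : ℤ) - (2 * ((r : ℤ) / 8) - 1) ≤ x 1 ∧ x 1 ≤ 2 * (r : ℤ) + (2 * ((r : ℤ) / 8) - 1) ∧
                -(2 * (r : ℤ)) - (2 * ((r : ℤ) / 8) - 1) ≤ x 2 ∧ x 2 ≤ 5 * ((r : ℤ) / 8) - 1} \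
              {x : Site 3 | -(r : ℤ) ≤ x 0 ∧ x 0 ≤ 2 * (r : ℤ) ∧ -(r : ℤ) ≤ x 1 ∧ x 1 ≤ 2 * (r : ℤ) ∧
                -(2 * (r : ℤ)) ≤ x 2 ∧ x 2 ≤ 3 * ((r : ℤ) / 8)}) u w} := by
  obtain ⟨cX, hcX, hX⟩ := hXB
  have hcX1 : cX ≤ 1 := by
    have h := hX 1 le_rfl
    have h0 : 0 ≤ (bondPercolation (zdGraph 3) (criticalProbI 3)).real
        {ω | ∃ x ∈ box 3 1, ∃ y ∈ innerBoundary (zdGraph 3) (box 3 (2 * 1)),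
          ω ∈ openConnIn ↑(box 3 (2 * 1)) x y} := measureReal_nonneg
    linarith
  refine ⟨cX ^ (51 ^ 3), by positivity, fun r hr64 => ?_⟩
  -- the objects
  set k : ℤ := (r : ℤ) / 8 with hk
  have hk8 : 8 ≤ k := by omega
  have hkr : 8 * k ≤ (r : ℤ) ∧ (r : ℤ) ≤ 8 * k + 7 := by omega
  set R : Set (Site 3) :=
    {x : Site 3 | -(r : ℤ) ≤ x 0 ∧ x 0 ≤ 2 * (r : ℤ) ∧ -(r : ℤ) ≤ x 1 ∧ x 1 ≤ 2 * (r : ℤ) ∧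
      -(2 * (r : ℤ)) ≤ x 2 ∧ x 2 ≤ 3 * k} with hR_def
  set R' : Set (Site 3) :=
    {x : Site 3 | -(r : ℤ) - (2 * k - 1) ≤ x 0 ∧ x 0 ≤ 2 * (r : ℤ) + (2 * k - 1) ∧
      -(r : ℤ) - (2 * k - 1) ≤ x 1 ∧ x 1 ≤ 2 * (r : ℤ) + (2 * k - 1) ∧
      -(2 * (r : ℤ)) - (2 * k - 1) ≤ x 2 ∧ x 2 ≤ 5 * k - 1} with hR'_def
  set s : ℕ := r / 16 - 1 with hs
  have hs_cast : (s : ℤ) = (r : ℤ) / 16 - 1 := by omega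
  have hsk : 2 * (s : ℤ) ≤ k - 2 ∧ k - 3 ≤ 2 * (s : ℤ) := by omega
  have hs1 : 1 ≤ s := by omega
  set g : ℤ := 2 * (s : ℤ) + 1 with hg
  have hgpos : 0 < g := by omega
  set anchor : Site 3 := ![4 * k, 4 * k, -(8 * k)] with hanchor
  have ha0 : anchor 0 = 4 * k := rfl
  have ha1 : anchor 1 = 4 * k := rfl
  have ha2 : anchor 2 = -(8 * k) := rfl
  set F : Site 3 → Site 3 := fun j i => anchor i + g * j i with hF
  set J : Finset (Site 3) := (box 3 25).image F with hJ_def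
  have hJcard : J.card ≤ 51 ^ 3 :=
    le_trans Finset.card_image_le (by rw [card_box])
  -- membership unfolding
  have mem_R : ∀ u : Site 3, u ∈ R ↔
      -(r : ℤ) ≤ u 0 ∧ u 0 ≤ 2 * (r : ℤ) ∧ -(r : ℤ) ≤ u 1 ∧ u 1 ≤ 2 * (r : ℤ) ∧
      -(2 * (r : ℤ)) ≤ u 2 ∧ u 2 ≤ 3 * k := fun u => Iff.rfl
  have mem_R' : ∀ u : Site 3, u ∈ R' ↔
      -(r : ℤ) - (2 * k - 1) ≤ u 0 ∧ u 0 ≤ 2 * (r : ℤ) + (2 * k - 1) ∧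
      -(r : ℤ) - (2 * k - 1) ≤ u 1 ∧ u 1 ≤ 2 * (r : ℤ) + (2 * k - 1) ∧
      -(2 * (r : ℤ)) - (2 * k - 1) ≤ u 2 ∧ u 2 ≤ 5 * k - 1 := fun u => Iff.rfl
  -- the cover: every vertex adjacent to `R` lies in a tile of the grid whose doubled tile (plus one layer) is inside `R'`
  have hcover : ∀ u ∈ R' \ R, (∃ z ∈ R, (zdGraph 3).Adj u z) →
      ∃ v ∈ J, u - v ∈ box 3 s ∧
        ∀ y : Site 3, y - v ∈ box 3 (2 * s) → ∀ z : Site 3, (zdGraph 3).Adj y z → z ∈ R' := by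
    rintro u - ⟨z₀, hz₀, huz₀⟩
    rw [mem_R] at hz₀
    have hb0 := zdGraph_adj_apply_le huz₀ 0
    have hb1 := zdGraph_adj_apply_le huz₀ 1
    have hb2 := zdGraph_adj_apply_le huz₀ 2
    -- the tile index of `u`
    set q : Site 3 := fun i => (u i - anchor i + s) / g with hq
    have hdiv : ∀ i, (u i - anchor i + s) % g + g * q i = u i - anchor i + s ∧
        0 ≤ (u i - anchor i + s) % g ∧ (u i - anchor i + s) % g < g := fun i =>
      ⟨Int.emod_add_mul_ediv _ _, Int.emod_nonneg _ hgpos.ne', Int.emod_lt_of_pos _ hgpos⟩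
    -- a priori bounds on `u - anchor`
    have hlo : ∀ i, -(14 * k + 13) ≤ u i - anchor i ∧ u i - anchor i ≤ 14 * k + 13 := by
      intro i
      fin_cases i <;>
        simp only [ha0, ha1, ha2, Fin.zero_eta, Fin.mk_one, Fin.reduceFinMk, Fin.isValue] <;> omega
    refine ⟨F q, ?_, ?_, ?_⟩
    · -- `F q ∈ J`
      rw [hJ_def, Finset.mem_image]
      refine ⟨q, ?_, rfl⟩
      rw [mem_box]
      intro i
      obtain ⟨he, h0, h1⟩ := hdiv i
      obtain ⟨hl, hu⟩ := hlo i
      constructor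
      · by_contra hlt
        push Not at hlt
        have hm : g * q i ≤ g * (-26) := mul_le_mul_of_nonneg_left (by omega) hgpos.le
        generalize g * q i = X at he hm
        generalize (u i - anchor i + s) % g = Y at he h0 h1
        omega
      · by_contra hlt
        push Not at hlt
        have hm : g * 26 ≤ g * q i := mul_le_mul_of_nonneg_left (by omega) hgpos.le
        generalize g * q i = X at he hm
        generalize (u i - anchor i + s) % g = Y at he h0 h1
        omega
    · -- `u - F q ∈ B(s)`
      rw [mem_box]
      intro i
      obtain ⟨he, h0, h1⟩ := hdiv i
      change -(s : ℤ) ≤ u i - (anchor i + g * q i) ∧ u i - (anchor i + g * q i) ≤ (s : ℤ)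
      generalize g * q i = X at he ⊢
      generalize (u i - anchor i + s) % g = Y at he h0 h1
      omega
    · -- room: neighbours of `F q + B(2s)` lie in `R'`
      intro y hy z hyz
      rw [mem_box] at hy
      rw [mem_R']
      have hy0 := hy 0
      have hy1 := hy 1
      have hy2 := hy 2
      change -((2 * s : ℕ) : ℤ) ≤ y 0 - (anchor 0 + g * q 0) ∧ y 0 - (anchor 0 + g * q 0) ≤ ((2 * s : ℕ) : ℤ)
        at hy0
      change -((2 * s : ℕ) : ℤ) ≤ y 1 - (anchor 1 + g * q 1) ∧ y 1 - (anchor 1 + g * q 1) ≤ ((2 * s : ℕ) : ℤ)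
        at hy1
      change -((2 * s : ℕ) : ℤ) ≤ y 2 - (anchor 2 + g * q 2) ∧ y 2 - (anchor 2 + g * q 2) ≤ ((2 * s : ℕ) : ℤ)
        at hy2
      have hz0 := zdGraph_adj_apply_le hyz 0
      have hz1 := zdGraph_adj_apply_le hyz 1
      have hz2 := zdGraph_adj_apply_le hyz 2
      obtain ⟨he0, h00, h10⟩ := hdiv 0
      obtain ⟨he1, h01, h11⟩ := hdiv 1
      obtain ⟨he2, h02, h12⟩ := hdiv 2
      generalize g * q 0 = X0 at he0 hy0
      generalize g * q 1 = X1 at he1 hy1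
      generalize g * q 2 = X2 at he2 hy2
      generalize (u 0 - anchor 0 + s) % g = Y0 at he0 h00 h10
      generalize (u 1 - anchor 1 + s) % g = Y1 at he1 h01 h11
      generalize (u 2 - anchor 2 + s) % g = Y2 at he2 h02 h12
      push_cast at hy0 hy1 hy2
      omega
  -- the tiled shell has probability ≥ cX ^ |J| ≥ cX ^ 51³
  have hT := stub_tiledShell (criticalProbI 3) s cX hcX.le (hX s hs1) R R' J hcover
  exact le_trans (pow_le_pow_of_le_one hcX.le hcX1 hJcard) hT

end Summit.CriticalPhenomena.PercolationContinuityZ3.Theorems.TetrahedronHarrisGap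

end
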